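import Literature.MathematicalPhysics.QuantumLattice.HubbardChainEnergyDensity
import HarnessLib

/-!
# The ground-state energy density of the Hubbard chain at a general (rational) filling

Topic `MathematicalPhysics/QuantumLattice` (family `hubbard`). Companion of
`HubbardChainEnergyDensity.lean`, which names the thermodynamic limit of the HALF-FILLED chain only
(`ThermodynamicLimit.hubbardChainEnergyDensity t U = lim E_L(L)/L`). Here the filling is a rational
number `n = p/q ∈ [0, 2]` of electrons per site and the limit is taken along the rings whose length
is a multiple of `q`:

* `ThermodynamicLimit.hubbardChainEnergyDensityAt t U p q = lim_{m → ∞} E_{qm}(pm)/(qm)`, where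
  `E_L(N) = groundEnergyAt (fermionTorusGraph 1 L) t U N` is the `N`-electron sector ground-state energy
  (all `S^z`) of the Hubbard ring `ℤ/Lℤ`. A `limUnder`; the limit exists for `U ≥ 0`, `1 ≤ q`,
  `p ≤ 2q` (`tendsto_hubbardChainEnergyDensityAt`: Fekete's lemma for `u(m) = E_{qm}(pm) + 8|t|`, which is
  subadditive by the filling-general ring cut `groundEnergyAt_ring_le_add` and bounded below by
  `neg_le_groundEnergyAt_ring`) — Ruelle, *Statistical Mechanics* (1969) §2.2 (thermodynamic limit of
  the ground-state energy density by subadditivity); this is the object Lieb–Wu 1968 compute at every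
  density by the Bethe ansatz.

API, parallel to the half-filled file (everything PROVED; the only definition is the name of the limit;
no named facts):

* `hubbardChainEnergyDensityAt_le` / `_le_of_le` — the limit is an infimum up to the surface term:
  `e ≤ E_{qm}(pm)/(qm) + 8|t|/(qm)` for every `m ≥ 1`, so ONE certified upper bound on a finite ring is a
  thermodynamic-limit upper bound;
* `hubbardChainEnergyDensityAt_ge_of_eventually_ge` / `_ge_of_forall_ge` — ring-wise lower bounds
  `b ≤ E_{qm}(pm)/(qm)` for all large `m` pass to the limit (the logical shape of certificate rows);
* `hubbardChainEnergyDensityAt_one_one` — at `p = q = 1` this is the half-filled density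
  `hubbardChainEnergyDensity t U`;
* `hubbardChainEnergyDensityAt_mul` — the value depends on `p/q` only: `e(kp, kq) = e(p, q)` (`k ≥ 1`).
* `hubbardChainEnergyDensityAt_ge_of_window_certificate` — a window certificate with density rows
  `n_{0σ} = p/(2q)` (Han 2020 §2, the tree's `hubbardChain_energyPerSite_ge_of_window_certificate` on the
  rings `q·2k` with `p·2k` electrons) bounds `e(p, q)` from below by its certified constant.

Requested by the certified-many-body-solver venture (doped calibration row `n = 1/2`: `p = 1, q = 2`).

## References

* D. Ruelle, *Statistical Mechanics: Rigorous Results* (Benjamin, 1969), §2.2. [Ruelle1969]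
* E. H. Lieb, F. Y. Wu, Phys. Rev. Lett. 20 (1968) 1445 (the ground-state energy of the Hubbard chain
  as a function of the density). [LiebWuPRL1968]
-/

noncomputable section

open Filter Topology Matrix Finset
open scoped BigOperators

namespace Literature.MathematicalPhysics.QuantumLattice

namespace ThermodynamicLimit

/-! ### Existence of the limit along `L = qm`, `N = pm` -/

/-- **Thermodynamic limit of the Hubbard ring at filling `p/q`**: for `U ≥ 0`, `1 ≤ q` and `p ≤ 2q`
the sequence `E_{qm}(pm)/(qm)` converges as `m → ∞`. Proof: `u(m) = E_{qm}(pm) + 8|t|` is subadditive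
by the ring cut and `u(m)/m ≥ −4|t| q`, so Fekete's lemma applies; `8|t|/(qm) → 0`.
[cite: Ruelle1969, §2.2] -/
theorem tendsto_energyDensity_ring_filling (t : ℝ) {U : ℝ} (hU : 0 ≤ U) {p q : ℕ} (hq : 1 ≤ q)
    (hp : p ≤ 2 * q) :
    ∃ e : ℝ, Tendsto (fun m : ℕ =>
      groundEnergyAt (fermionTorusGraph 1 (q * m)) t U (p * m) / ((q * m : ℕ) : ℝ)) atTop (𝓝 e) := by
  set f : ℕ → ℕ → ℝ := fun L N => groundEnergyAt (fermionTorusGraph 1 L) t U N with hf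
  set u : ℕ → ℝ := fun m => f (q * m) (p * m) + 8 * |t| with hu
  have hsub : Subadditive u := by
    intro m n
    have h := groundEnergyAt_ring_le_add (q * m) (q * n) t U (N₁ := p * m) (N₂ := p * n)
      (by nlinarith) (by nlinarith)
    have h1 : f (q * (m + n)) (p * (m + n)) = f (q * m + q * n) (p * m + p * n) := by
      rw [mul_add, mul_add]
    simp only [hu]
    rw [h1]
    simp only [hf] at h ⊢
    linarith
  have hbdd : BddBelow (Set.range fun n => u n / n) := by
    refine ⟨-(4 * |t| * q), ?_⟩
    rintro _ ⟨m, rfl⟩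
    rcases Nat.eq_zero_or_pos m with rfl | hm
    · simp only [CharP.cast_eq_zero, div_zero]
      have : 0 ≤ |t| := abs_nonneg t
      have hq' : (0 : ℝ) ≤ q := by positivity
      nlinarith
    · have h := neg_le_groundEnergyAt_ring (q * m) t hU (N := p * m) (by nlinarith)
      have hm' : (0 : ℝ) < m := by exact_mod_cast hm
      rw [le_div_iff₀ hm', hu]
      simp only [hf]
      have : 0 ≤ |t| := abs_nonneg t
      push_cast at h ⊢
      nlinarith
  refine ⟨hsub.lim / q, ?_⟩
  have hlim := hsub.tendsto_lim hbdd
  have hq0 : (q : ℝ) ≠ 0 := by exact_mod_cast (by omega : q ≠ 0)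
  have h0 : Tendsto (fun m : ℕ => (8 * |t|) / (((q * m : ℕ) : ℝ))) atTop (𝓝 0) := by
    have h1 : Tendsto (fun m : ℕ => ((q * m : ℕ) : ℝ)) atTop atTop := by
      refine tendsto_natCast_atTop_atTop.comp ?_
      exact tendsto_atTop_mono (fun m => Nat.le_mul_of_pos_left m hq) tendsto_id
    exact tendsto_const_nhds.div_atTop h1
  have heq : (fun m : ℕ => groundEnergyAt (fermionTorusGraph 1 (q * m)) t U (p * m) / ((q * m : ℕ) : ℝ)) =
      fun m : ℕ => (u m / m) / q - (8 * |t|) / ((q * m : ℕ) : ℝ) := by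
    funext m
    rcases Nat.eq_zero_or_pos m with rfl | hm
    · simp [hu]
    · have hm' : (m : ℝ) ≠ 0 := by exact_mod_cast hm.ne'
      simp only [hu, hf]
      push_cast
      field_simp
      ring
  rw [heq, ← sub_zero (hsub.lim / q)]
  exact (hlim.div_const (q : ℝ)).sub h0

/-- **The ground-state energy density of the Hubbard chain at filling `p/q`** (electrons per site;
`p ≤ 2q`): `e(t, U; p/q) = lim_{m→∞} E_{qm}(pm)/(qm)` along the rings `ℤ/(qm)ℤ`
(`fermionTorusGraph 1 (qm)`), `E_L(N)` the `N`-electron sector ground-state energy (all `S^z`).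
A `limUnder`; it exists for `U ≥ 0` (`tendsto_hubbardChainEnergyDensityAt`) and depends on `p/q` only
(`hubbardChainEnergyDensityAt_mul`); at `p = q = 1` it is `hubbardChainEnergyDensity t U`.
Ruelle (1969) §2.2 (existence by subadditivity); the quantity computed at every density by Lieb–Wu
(1968). [cite: Ruelle1969, §2.2] -/
def hubbardChainEnergyDensityAt (t U : ℝ) (p q : ℕ) : ℝ :=
  limUnder atTop (fun m : ℕ =>
    groundEnergyAt (fermionTorusGraph 1 (q * m)) t U (p * m) / ((q * m : ℕ) : ℝ))

/-- The defining limit: `E_{qm}(pm)/(qm) → e(t, U; p/q)` for `U ≥ 0`, `1 ≤ q`, `p ≤ 2q`.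
[cite: Ruelle1969, §2.2] -/
theorem tendsto_hubbardChainEnergyDensityAt (t : ℝ) {U : ℝ} (hU : 0 ≤ U) {p q : ℕ} (hq : 1 ≤ q)
    (hp : p ≤ 2 * q) :
    Tendsto (fun m : ℕ => groundEnergyAt (fermionTorusGraph 1 (q * m)) t U (p * m) / ((q * m : ℕ) : ℝ))
      atTop (𝓝 (hubbardChainEnergyDensityAt t U p q)) :=
  tendsto_nhds_limUnder (tendsto_energyDensity_ring_filling t hU hq hp)

/-- At `p = q = 1` (half filling) the general-filling density is the half-filled density of
`HubbardChainEnergyDensity.lean`. [cite: Ruelle1969, §2.2] -/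
theorem hubbardChainEnergyDensityAt_one_one (t : ℝ) {U : ℝ} (hU : 0 ≤ U) :
    hubbardChainEnergyDensityAt t U 1 1 = hubbardChainEnergyDensity t U := by
  have h1 := tendsto_hubbardChainEnergyDensityAt t hU (p := 1) (q := 1) le_rfl (by norm_num)
  have h2 := tendsto_hubbardChainEnergyDensity t hU
  have h2' : Tendsto (fun m : ℕ => groundEnergyAt (fermionTorusGraph 1 m) t U m / ((m : ℕ) : ℝ)) atTop
      (𝓝 (hubbardChainEnergyDensity t U)) := by
    refine h2.congr' (Eventually.of_forall fun m => ?_)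
    rw [energyPerSite_fermionTorusGraph_one]
  have hone : Tendsto (fun m : ℕ => 1 * m) atTop atTop :=
    tendsto_atTop_mono (fun m => le_of_eq (one_mul m).symm) tendsto_id
  exact tendsto_nhds_unique h1 (h2'.comp hone)

/-- The density depends on the ratio `p/q` only: `e(kp, kq) = e(p, q)` for `k ≥ 1` (the defining
sequence of `(kp, kq)` is a subsequence of that of `(p, q)`). [cite: Ruelle1969, §2.2] -/
theorem hubbardChainEnergyDensityAt_mul (t : ℝ) {U : ℝ} (hU : 0 ≤ U) {p q k : ℕ} (hq : 1 ≤ q)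
    (hp : p ≤ 2 * q) (hk : 1 ≤ k) :
    hubbardChainEnergyDensityAt t U (k * p) (k * q) = hubbardChainEnergyDensityAt t U p q := by
  have h1 := tendsto_hubbardChainEnergyDensityAt t hU (p := k * p) (q := k * q) (by nlinarith)
    (by nlinarith)
  have h2 := tendsto_hubbardChainEnergyDensityAt t hU hq hp
  have hseq : Tendsto (fun m : ℕ => k * m) atTop atTop :=
    tendsto_atTop_mono (fun m => Nat.le_mul_of_pos_left m hk) tendsto_id
  have h3 := h2.comp hseq
  have heq : (fun m : ℕ => groundEnergyAt (fermionTorusGraph 1 (k * q * m)) t U (k * p * m) /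
      ((k * q * m : ℕ) : ℝ)) = (fun m : ℕ => groundEnergyAt (fermionTorusGraph 1 (q * m)) t U (p * m) /
      ((q * m : ℕ) : ℝ)) ∘ fun m : ℕ => k * m := by
    funext m
    simp only [Function.comp]
    have e1 : k * q * m = q * (k * m) := by ring
    have e2 : k * p * m = p * (k * m) := by ring
    rw [e1, e2]
  rw [heq] at h1
  exact tendsto_nhds_unique h1 h3

/-! ### The limit is an infimum: finite rings bound it from above -/

/-- **Subadditive upper bound at every finite size.** For `U ≥ 0`, `1 ≤ q`, `p ≤ 2q` and every
`m ≥ 1`: `e(t, U; p/q) ≤ E_{qm}(pm)/(qm) + 8|t|/(qm)`. (`u(jm) ≤ j·u(m) + u(0)` for the subadditive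
`u(m) = E_{qm}(pm) + 8|t|`; divide by `qjm` and let `j → ∞`.) [cite: Ruelle1969, §2.2] -/
theorem hubbardChainEnergyDensityAt_le (t : ℝ) {U : ℝ} (hU : 0 ≤ U) {p q : ℕ} (hq : 1 ≤ q)
    (hp : p ≤ 2 * q) {m : ℕ} (hm : 1 ≤ m) :
    hubbardChainEnergyDensityAt t U p q ≤
      groundEnergyAt (fermionTorusGraph 1 (q * m)) t U (p * m) / ((q * m : ℕ) : ℝ) +
        8 * |t| / ((q * m : ℕ) : ℝ) := by
  set f : ℕ → ℕ → ℝ := fun L N => groundEnergyAt (fermionTorusGraph 1 L) t U N with hf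
  set u : ℕ → ℝ := fun m => f (q * m) (p * m) + 8 * |t| with hu
  have hsub : Subadditive u := by
    intro a b
    have h := groundEnergyAt_ring_le_add (q * a) (q * b) t U (N₁ := p * a) (N₂ := p * b)
      (by nlinarith) (by nlinarith)
    have h1 : f (q * (a + b)) (p * (a + b)) = f (q * a + q * b) (p * a + p * b) := by
      rw [mul_add, mul_add]
    simp only [hu]
    rw [h1]
    simp only [hf] at h ⊢
    linarith
  -- along the subsequence `(j+1) m`
  have hseq : Tendsto (fun j : ℕ => (j + 1) * m) atTop atTop :=
    tendsto_atTop_mono (fun j => (Nat.le_succ j).trans (Nat.le_mul_of_pos_right _ hm)) tendsto_id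
  have hlim := (tendsto_hubbardChainEnergyDensityAt t hU hq hp).comp hseq
  have hqm : (0 : ℝ) < ((q * m : ℕ) : ℝ) := by
    have : 0 < q * m := Nat.mul_pos (by omega) (by omega)
    exact_mod_cast this
  have hcomp : Tendsto (fun j : ℕ => u m / ((q * m : ℕ) : ℝ) + u 0 / ((q * ((j + 1) * m) : ℕ) : ℝ))
      atTop (𝓝 (u m / ((q * m : ℕ) : ℝ) + 0)) := by
    refine tendsto_const_nhds.add ?_
    have h1 : Tendsto (fun j : ℕ => ((q * ((j + 1) * m) : ℕ) : ℝ)) atTop atTop := by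
      refine tendsto_natCast_atTop_atTop.comp ?_
      exact tendsto_atTop_mono (fun j => Nat.le_mul_of_pos_left _ hq) hseq
    exact tendsto_const_nhds.div_atTop h1
  rw [add_zero] at hcomp
  have hle : ∀ j : ℕ, groundEnergyAt (fermionTorusGraph 1 (q * ((j + 1) * m))) t U (p * ((j + 1) * m)) /
      ((q * ((j + 1) * m) : ℕ) : ℝ) ≤ u m / ((q * m : ℕ) : ℝ) + u 0 / ((q * ((j + 1) * m) : ℕ) : ℝ) := by
    intro j
    have hk := hsub.apply_mul_add_le (j + 1) m 0
    rw [add_zero] at hk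
    have hkm : (0 : ℝ) < ((q * ((j + 1) * m) : ℕ) : ℝ) := by
      have : 0 < q * ((j + 1) * m) := Nat.mul_pos (by omega) (Nat.mul_pos (by omega) (by omega))
      exact_mod_cast this
    rw [div_le_iff₀ hkm]
    have hE : groundEnergyAt (fermionTorusGraph 1 (q * ((j + 1) * m))) t U (p * ((j + 1) * m)) =
        u ((j + 1) * m) - 8 * |t| := by simp [hu, hf]
    rw [hE]
    have ht : 0 ≤ 8 * |t| := by positivity
    have hexp : (u m / ((q * m : ℕ) : ℝ) + u 0 / ((q * ((j + 1) * m) : ℕ) : ℝ)) *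
        ((q * ((j + 1) * m) : ℕ) : ℝ) = ((j + 1 : ℕ) : ℝ) * u m + u 0 := by
      field_simp
      push_cast
      ring
    rw [hexp]
    linarith
  have := le_of_tendsto_of_tendsto' hlim hcomp hle
  have hum : u m / ((q * m : ℕ) : ℝ) = groundEnergyAt (fermionTorusGraph 1 (q * m)) t U (p * m) /
      ((q * m : ℕ) : ℝ) + 8 * |t| / ((q * m : ℕ) : ℝ) := by
    simp only [hu, hf, add_div]
  rw [hum] at this
  exact this

/-- **A certified upper bound on one ring bounds the thermodynamic limit**: `E_{qm}(pm) ≤ B`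
(`m ≥ 1`, `U ≥ 0`) gives `e(t, U; p/q) ≤ B/(qm) + 8|t|/(qm)`. [cite: Ruelle1969, §2.2] -/
theorem hubbardChainEnergyDensityAt_le_of_le (t : ℝ) {U : ℝ} (hU : 0 ≤ U) {p q : ℕ} (hq : 1 ≤ q)
    (hp : p ≤ 2 * q) {m : ℕ} (hm : 1 ≤ m) {B : ℝ}
    (h : groundEnergyAt (fermionTorusGraph 1 (q * m)) t U (p * m) ≤ B) :
    hubbardChainEnergyDensityAt t U p q ≤ B / ((q * m : ℕ) : ℝ) + 8 * |t| / ((q * m : ℕ) : ℝ) := by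
  have hqm : (0 : ℝ) < ((q * m : ℕ) : ℝ) := by
    have : 0 < q * m := Nat.mul_pos (by omega) (by omega)
    exact_mod_cast this
  exact (hubbardChainEnergyDensityAt_le t hU hq hp hm).trans (by gcongr)

/-! ### Eventual ring-wise lower bounds pass to the limit -/

/-- **Ring-wise lower bounds give a lower bound on the limit**: if `b ≤ E_{qm}(pm)/(qm)` for all
sufficiently large `m`, then `b ≤ e(t, U; p/q)` (`U ≥ 0`). This is the logical form of certificate rows
`∀ m ≥ m₀, b ≤ groundEnergyAt (fermionTorusGraph 1 (q m)) t U (p m) / (q m)`.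
[cite: Ruelle1969, §2.2] -/
theorem hubbardChainEnergyDensityAt_ge_of_eventually_ge (t : ℝ) {U : ℝ} (hU : 0 ≤ U) {p q : ℕ}
    (hq : 1 ≤ q) (hp : p ≤ 2 * q) {b : ℝ}
    (h : ∀ᶠ m : ℕ in atTop,
      b ≤ groundEnergyAt (fermionTorusGraph 1 (q * m)) t U (p * m) / ((q * m : ℕ) : ℝ)) :
    b ≤ hubbardChainEnergyDensityAt t U p q :=
  ge_of_tendsto (tendsto_hubbardChainEnergyDensityAt t hU hq hp) h

/-- The same with an explicit threshold `m₀`. [cite: Ruelle1969, §2.2] -/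
theorem hubbardChainEnergyDensityAt_ge_of_forall_ge (t : ℝ) {U : ℝ} (hU : 0 ≤ U) {p q : ℕ}
    (hq : 1 ≤ q) (hp : p ≤ 2 * q) {b : ℝ} (m₀ : ℕ)
    (h : ∀ m : ℕ, m₀ ≤ m →
      b ≤ groundEnergyAt (fermionTorusGraph 1 (q * m)) t U (p * m) / ((q * m : ℕ) : ℝ)) :
    b ≤ hubbardChainEnergyDensityAt t U p q :=
  hubbardChainEnergyDensityAt_ge_of_eventually_ge t hU hq hp (eventually_atTop.2 ⟨m₀, h⟩)

/-- **Frequent ring-wise lower bounds suffice** (rows stated only along a further subsequence, e.g.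
`m` even so that `pm` is even): if `b ≤ E_{qm}(pm)/(qm)` for arbitrarily large `m`, then
`b ≤ e(t, U; p/q)`. [cite: Ruelle1969, §2.2] -/
theorem hubbardChainEnergyDensityAt_ge_of_frequently_ge (t : ℝ) {U : ℝ} (hU : 0 ≤ U) {p q : ℕ}
    (hq : 1 ≤ q) (hp : p ≤ 2 * q) {b : ℝ}
    (h : ∃ᶠ m : ℕ in atTop,
      b ≤ groundEnergyAt (fermionTorusGraph 1 (q * m)) t U (p * m) / ((q * m : ℕ) : ℝ)) :
    b ≤ hubbardChainEnergyDensityAt t U p q := by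
  have ht := tendsto_hubbardChainEnergyDensityAt t hU hq hp
  rcases le_or_gt b (hubbardChainEnergyDensityAt t U p q) with hle | hlt
  · exact hle
  · exfalso
    have hev := (tendsto_order.1 ht).2 b hlt
    obtain ⟨m, hm1, hm2⟩ := (h.and_eventually hev).exists
    exact absurd hm2 (not_lt.2 hm1)

/-! ### Window certificates at general filling ⇒ lower bounds on the ring limit -/

section Window

open HubbardWave0 Literature.Probability.LatticeModels
open Literature.MathematicalPhysics.QuantumManyBody.StateRelaxation
open scoped ComplexOrder

/-- **Window certificate with density rows `n_{0σ} = p/(2q)` ⇒ lower bound on the ring-limit energy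
density at filling `p/q`.** The tree's finite-ring consumer
`hubbardChain_energyPerSite_ge_of_window_certificate` (Han 2020 §2: positivity, `⟨[H,O]⟩ = 0`, the
space group `x ↦ εx + v` of the chain, vanishing of charged words, density multipliers `μ_σ` with target
`ν`) gives, on EVERY ring `L ≥ 3` on which the window does not wrap and for every `n_h ≤ L`,
`c − Σₖ ‖aₖ‖ + (Σ_σ μ_σ)(n_h/L − ν) ≤ E₀(L, 2n_h)/L`. On the rings `L = q·2k` with `n_h = p·k` and
`ν = p/(2q)` the multiplier term vanishes, so `c − Σₖ ‖aₖ‖ ≤ E₀(q·2k, p·2k)/(q·2k)` for all large `k`,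
and `hubbardChainEnergyDensityAt_ge_of_frequently_ge` passes to the limit (`0 ≤ U`, `p ≤ 2q`). This is
the doped analogue of `hubbardChainEnergyDensity_ge_of_window_certificate` (half filling, `ν = 1/2`);
no convexity-in-density or chemical-potential lemma is used: the bound is ring-wise feasibility at the
certificate's own density. [cite: Han2020Bootstrap, §2] [cite: Ruelle1969, §2.2] -/
theorem hubbardChainEnergyDensityAt_ge_of_window_certificate (t : ℝ) {U : ℝ} (hU : 0 ≤ U) {p q : ℕ}
    (hq : 1 ≤ q) (hp : p ≤ 2 * q)
    {Λ Λ' : Finset (Site 1)} (hΛ : Λ ⊆ Λ')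
    (hclosed : ∀ x ∈ Λ, ∀ i : Fin 1, x + unitVec i ∈ Λ' ∧ x - unitVec i ∈ Λ')
    (h0 : thicken ({0} : Finset (Site 1)) 1 ⊆ Λ') (hz : (0 : Site 1) ∈ Λ')
    (μ : Fin 2 → ℝ)
    {m : Type*} [Fintype m] [DecidableEq m] {Λm : Matrix m m ℂ} (hΛm : Λm.PosSemidef)
    (O : m → FermionOp Λ')
    {κ : Type*} (s : Finset κ) (B : κ → FermionOp Λ)
    {ι : Type*} (tt : Finset ι) (ε : ι → ℤˣ) (v : ι → Site 1)
    (hsh : ∀ l, affShiftSet (ε l) (v l) Λ ⊆ Λ')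
    (Y : ι → FermionOp Λ)
    {γ : Type*} (u : Finset γ) (b : γ → ℂ) (cw : γ → List (Orb (PolySite Λ') × Bool))
    (hcw : ∀ j ∈ u, ladderCharge (cw j) ≠ 0 ∨ ladderSpinCharge (cw j) ≠ 0)
    {δ : Type*} (ah : Finset δ) (dc : δ → ℝ) (V : δ → FermionOp Λ')
    {κ'' : Type*} (w : Finset κ'') (a : κ'' → ℂ) (word : κ'' → List (Orb (PolySite Λ') × Bool))
    {c : ℝ}
    (hcert : fermionEmbed (PolySite.incl h0) ((hubbardFermionInteraction 1 t U).meanEnergyObs 1) -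
        (c : ℂ) • (1 : FermionOp Λ') -
        ∑ σ : Fin 2, ((μ σ : ℝ) : ℂ) •
          (nAt 0 hz σ - (((p : ℝ) / (2 * (q : ℝ)) : ℝ) : ℂ) • (1 : FermionOp Λ')) =
      gramForm Λm O +
        (∑ k ∈ s, ((hubbardFermionInteraction 1 t U).localHamiltonian Λ' *
              fermionEmbed (PolySite.incl hΛ) (B k) -
            fermionEmbed (PolySite.incl hΛ) (B k) * (hubbardFermionInteraction 1 t U).localHamiltonian Λ') +
          ∑ l ∈ tt, (fermionEmbed (PolySite.incl (hsh l))
              (fermionEmbed (PolySite.affEmb (ε l) (v l) Λ) (Y l)) -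
            fermionEmbed (PolySite.incl hΛ) (Y l)) +
          ∑ j ∈ u, b j • ladderWord (cw j)) +
        (∑ m' ∈ ah, ((dc m' : ℝ) : ℂ) • ((V m')ᴴ - V m') + ∑ k ∈ w, a k • ladderWord (word k))) :
    c - ∑ k ∈ w, ‖a k‖ ≤ hubbardChainEnergyDensityAt t U p q := by
  obtain ⟨L₀, hL₀⟩ := exists_forall_le_injOn_proj (thicken Λ' 1)
  refine hubbardChainEnergyDensityAt_ge_of_frequently_ge t hU hq hp (Filter.frequently_atTop.2 ?_)
  intro n
  -- the ring `L = q · (2k)` with `k ≥ max n L₀ 3` electrons-per-`q`-block count `n_h = p · k`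
  set k : ℕ := max n (max L₀ 3) with hk
  have hkn : n ≤ k := le_max_left _ _
  have hkL : L₀ ≤ k := le_trans (le_max_left _ _) (le_max_right _ _)
  have hk3 : 3 ≤ k := le_trans (le_max_right _ _) (le_max_right _ _)
  refine ⟨2 * k, by omega, ?_⟩
  have hL3 : 3 ≤ q * (2 * k) := le_trans hk3 (by nlinarith)
  have hLL : L₀ ≤ q * (2 * k) := le_trans hkL (by nlinarith)
  haveI : NeZero (q * (2 * k)) := ⟨by omega⟩
  have hn : p * k ≤ q * (2 * k) := by nlinarith
  have hmain := hubbardChain_energyPerSite_ge_of_window_certificate (L := q * (2 * k)) t U hL3 hn hΛ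
    hclosed h0 hz (hL₀ _ hLL) μ ((p : ℝ) / (2 * (q : ℝ))) hΛm O s B tt ε v hsh Y u b cw hcw ah dc V w a
    word hcert
  rw [energyPerSite_fermionTorusGraph_one] at hmain
  have hq0 : (q : ℝ) ≠ 0 := Nat.cast_ne_zero.2 (by omega)
  have hk0 : (k : ℝ) ≠ 0 := Nat.cast_ne_zero.2 (by omega)
  have key : ((p * k : ℕ) : ℝ) / ((q * (2 * k) : ℕ) : ℝ) - (p : ℝ) / (2 * (q : ℝ)) = 0 := by
    push_cast
    field_simp
    ring
  have hN : 2 * (p * k) = p * (2 * k) := by ring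
  rw [key, mul_zero, add_zero, hN] at hmain
  exact hmain

end Window

end ThermodynamicLimit

end Literature.MathematicalPhysics.QuantumLattice

end
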